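import Mathlib
import Summits.Ventures.PercRepro.TriangleCapTwoTrianglesTwoBelowA
import Summits.Ventures.PercRepro.TriangleCapSubDiagonalTriangles

/-!
# PercRepro — THE TWO-TRIANGLE CASE TWO BELOW THE DIAGONAL FOR `k ≥ 27`, AND THE `K₄⁻`-FREE CELLS TWO BELOW
THE DIAGONAL FOR `k ≥ 27` (p3, gen 36; part 52)

With two triangles `u v w`, `a b c` carrying every triangle vertex (`S = {u, v, w, a, b, c}`, `5 ≤ |S| ≤ 6`) and
fewer than `18` ordered triangles: every `z ∉ S` has `far(z) ≥ 4` (TriangleCapTwoTrianglesTwoBelowA), and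
`Σ_{z ∈ S} far(z) = Σ_{p} |{x ∈ S : x far from p}|` is at least the number of «good» ordered adjacent pairs — both
ends off `S`, or one end off `S` and the other in `S` but not the shared vertex — which are all but `≤ |S|(|S| − 1)` pairs
inside `S` and `≤ 2 |Sᶜ|` pairs hanging on the shared vertex.  So `Σ deficit ≥ 2 |Sᶜ| + 2m − 30 ≥ 6k − 48 ≥ 4k + 5`
for `k ≥ 27`, which with `2 Σ d² + Σ deficit = 2mk + |T₃| ≤ 2mk + 17` gives the cell.

* **`two_triangles_stability_two_large`** — `k ≥ 27`: the two-triangle case of the `r = 2` stability;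
* **`dense_stability_two_large`** — `K₄⁻`-free, `k ≥ 27`, `m ≥ 2k − 3`, not bipartite spanning with `≤ 1` missing
  cross pair ⇒ `Σ_v d(v)² + 2 (k − 3) ≤ m·k` (all cases are now theorems);
* **`two_below_diagonal_exact_k4m_large`** — THE CELLS TWO BELOW THE DIAGONAL ARE EXACT ON THE `K₄⁻`-FREE CLASS FOR
  EVERY `k ≥ 27`: for `m = a(k − a) − 2 ≥ 2k − 3` with `m, m + 1` not of the form `a′(k − a′)` the `K₄⁻`-free cherry
  maximum IS `(m(k − 2) − 2(k − 3))/2`, by `K_{a, k−a}` minus two edges at one vertex.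
Axioms: standard.
-/

namespace PercRepro

namespace TriangleCap

namespace C047

open Finset

variable {V : Type*} [Fintype V] [DecidableEq V]

omit [Fintype V] [DecidableEq V] in
/-- `{u, v, w} ⊆ S`. -/
theorem six_of_three_first {u v w a b c x : V} (h : x = u ∨ x = v ∨ x = w) :
    x = u ∨ x = v ∨ x = w ∨ x = a ∨ x = b ∨ x = c := by
  rcases h with h | h | h
  · exact Or.inl h
  · exact Or.inr (Or.inl h)
  · exact Or.inr (Or.inr (Or.inl h))

omit [Fintype V] [DecidableEq V] in
/-- `{a, b, c} ⊆ S`. -/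
theorem six_of_three_second {u v w a b c x : V} (h : x = a ∨ x = b ∨ x = c) :
    x = u ∨ x = v ∨ x = w ∨ x = a ∨ x = b ∨ x = c := by
  rcases h with h | h | h
  · exact Or.inr (Or.inr (Or.inr (Or.inl h)))
  · exact Or.inr (Or.inr (Or.inr (Or.inr (Or.inl h))))
  · exact Or.inr (Or.inr (Or.inr (Or.inr (Or.inr h))))

/-- The shared vertex of the two triangles is unique. -/
theorem shared_unique' (D : SimpleGraph V) [DecidableRel D.Adj] (hK : K4mFree D) {u v w a b c : V}
    (huv : D.Adj u v) (huw : D.Adj u w) (hvw : D.Adj v w) (hab : D.Adj a b) (hac : D.Adj a c) (hbc : D.Adj b c)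
    (ha : ¬ (a = u ∨ a = v ∨ a = w)) {t t' : V}
    (ht : (t = u ∨ t = v ∨ t = w) ∧ (t = a ∨ t = b ∨ t = c))
    (ht' : (t' = u ∨ t' = v ∨ t' = w) ∧ (t' = a ∨ t' = b ∨ t' = c)) : t = t' := by
  by_contra hne
  exact not_shared_edge D hK huv huw hvw hab hac hbc ha hne ht.1 ht'.1 ht.2 ht'.2

/-- A «good» ordered adjacent pair has a vertex of `S` far from it: both ends off `S`, or one end off `S` and the
other in `S` but not shared. -/
theorem one_le_card_far_of_good (D : SimpleGraph V) [DecidableRel D.Adj] (hK : K4mFree D) {u v w a b c : V}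
    (huv : D.Adj u v) (huw : D.Adj u w) (hvw : D.Adj v w) (hab : D.Adj a b) (hac : D.Adj a c) (hbc : D.Adj b c)
    (p : V × V)
    (hgood : (¬ (p.1 = u ∨ p.1 = v ∨ p.1 = w ∨ p.1 = a ∨ p.1 = b ∨ p.1 = c) ∧
        ¬ (p.2 = u ∨ p.2 = v ∨ p.2 = w ∨ p.2 = a ∨ p.2 = b ∨ p.2 = c)) ∨
      (¬ (p.1 = u ∨ p.1 = v ∨ p.1 = w ∨ p.1 = a ∨ p.1 = b ∨ p.1 = c) ∧
        (p.2 = u ∨ p.2 = v ∨ p.2 = w ∨ p.2 = a ∨ p.2 = b ∨ p.2 = c) ∧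
        ¬ ((p.2 = u ∨ p.2 = v ∨ p.2 = w) ∧ (p.2 = a ∨ p.2 = b ∨ p.2 = c))) ∨
      (¬ (p.2 = u ∨ p.2 = v ∨ p.2 = w ∨ p.2 = a ∨ p.2 = b ∨ p.2 = c) ∧
        (p.1 = u ∨ p.1 = v ∨ p.1 = w ∨ p.1 = a ∨ p.1 = b ∨ p.1 = c) ∧
        ¬ ((p.1 = u ∨ p.1 = v ∨ p.1 = w) ∧ (p.1 = a ∨ p.1 = b ∨ p.1 = c)))) :
    1 ≤ (({u, v, w, a, b, c} : Finset V).filter (fun x => ¬ D.Adj p.1 x ∧ ¬ D.Adj p.2 x)).card := by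
  apply card_pos.mpr
  -- a far vertex in one of the triangles
  have key : ∀ (r y : V), (¬ (r = u ∨ r = v ∨ r = w) ∧ ¬ (y = u ∨ y = v ∨ y = w)) ∨
      (¬ (r = a ∨ r = b ∨ r = c) ∧ ¬ (y = a ∨ y = b ∨ y = c)) →
      ∃ z ∈ ({u, v, w, a, b, c} : Finset V), ¬ D.Adj r z ∧ ¬ D.Adj y z := by
    rintro r y (⟨hr, hy⟩ | ⟨hr, hy⟩)
    · obtain ⟨z, hz, h1, h2⟩ := exists_nonadj_mem_of_triangle D hK huv huw hvw hr hy
      exact ⟨z, by simp only [mem_insert, mem_singleton]; exact six_of_three_first hz, h1, h2⟩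
    · obtain ⟨z, hz, h1, h2⟩ := exists_nonadj_mem_of_triangle D hK hab hac hbc hr hy
      exact ⟨z, by simp only [mem_insert, mem_singleton]; exact six_of_three_second hz, h1, h2⟩
  have hz : ∃ z ∈ ({u, v, w, a, b, c} : Finset V), ¬ D.Adj p.1 z ∧ ¬ D.Adj p.2 z := by
    rcases hgood with ⟨h1, h2⟩ | ⟨h1, h2, h3⟩ | ⟨h1, h2, h3⟩
    · exact key p.1 p.2 (Or.inl ⟨fun h => h1 (six_of_three_first h), fun h => h2 (six_of_three_first h)⟩)
    · by_cases hT2 : p.2 = a ∨ p.2 = b ∨ p.2 = c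
      · exact key p.1 p.2 (Or.inl ⟨fun h => h1 (six_of_three_first h), fun h => h3 ⟨h, hT2⟩⟩)
      · exact key p.1 p.2 (Or.inr ⟨fun h => h1 (six_of_three_second h), hT2⟩)
    · by_cases hT2 : p.1 = a ∨ p.1 = b ∨ p.1 = c
      · exact key p.1 p.2 (Or.inl ⟨fun h => h3 ⟨h, hT2⟩, fun h => h1 (six_of_three_first h)⟩)
      · exact key p.1 p.2 (Or.inr ⟨hT2, fun h => h1 (six_of_three_second h)⟩)
  obtain ⟨z, hzS, h1, h2⟩ := hz
  exact ⟨z, mem_filter.mpr ⟨hzS, h1, h2⟩⟩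

/-- **THE FAR COUNT AROUND TWO TRIANGLES, WITH THE HANGING PAIRS EXPLICIT:** with `S = {u, v, w, a, b, c}`, `P_S` the
ordered adjacent pairs inside `S` and `H₁`, `H₂` the ordered adjacent pairs hanging on a shared vertex (one end off `S`,
the other in both triangles), `2m + 4 |Sᶜ| ≤ Σ_z far(z) + |P_S| + |H₁| + |H₂|` — both ends off `S`, or one end off `S`
and the other not shared, pay `1` to the vertices of `S`; every vertex off `S` is far from `4` pairs. -/
theorem two_mul_card_edges_add_four_mul_le (D : SimpleGraph V) [DecidableRel D.Adj] (hK : K4mFree D)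
    {u v w a b c : V}
    (huv : D.Adj u v) (huw : D.Adj u w) (hvw : D.Adj v w) (hab : D.Adj a b) (hac : D.Adj a c) (hbc : D.Adj b c)
    (ha : ¬ (a = u ∨ a = v ∨ a = w)) :
    2 * D.edgeFinset.card + 4 * (({u, v, w, a, b, c} : Finset V)ᶜ).card ≤ ∑ z, far D z +
      ((adjPairsAll D).filter (fun p => p.1 ∈ ({u, v, w, a, b, c} : Finset V) ∧
        p.2 ∈ ({u, v, w, a, b, c} : Finset V))).card +
      ((adjPairsAll D).filter (fun p => p.1 ∉ ({u, v, w, a, b, c} : Finset V) ∧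
        ((p.2 = u ∨ p.2 = v ∨ p.2 = w) ∧ (p.2 = a ∨ p.2 = b ∨ p.2 = c)))).card +
      ((adjPairsAll D).filter (fun p => p.2 ∉ ({u, v, w, a, b, c} : Finset V) ∧
        ((p.1 = u ∨ p.1 = v ∨ p.1 = w) ∧ (p.1 = a ∨ p.1 = b ∨ p.1 = c)))).card := by
  set S : Finset V := {u, v, w, a, b, c} with hS
  have memS : ∀ x, x ∈ S ↔ (x = u ∨ x = v ∨ x = w ∨ x = a ∨ x = b ∨ x = c) := by
    intro x; rw [hS]; simp only [mem_insert, mem_singleton]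
  have hsplit := sum_add_sum_compl S (far D)
  -- off `S`: `far ≥ 4`
  have hR : 4 * Sᶜ.card ≤ ∑ z ∈ Sᶜ, far D z := by
    rw [card_eq_sum_ones, mul_sum]
    apply sum_le_sum
    intro z hz
    rw [mem_compl, memS] at hz
    simpa using far_ge_four_of_not_mem D hK huv huw hvw hab hac hbc ha hz
  -- on `S`: the double counting and the good pairs
  have hSsum : ∑ z ∈ S, far D z =
      ∑ p ∈ adjPairsAll D, (S.filter (fun x => ¬ D.Adj p.1 x ∧ ¬ D.Adj p.2 x)).card := by
    simp only [far, card_filter]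
    rw [sum_comm]
  set P := adjPairsAll D with hP
  set G : V × V → Prop := fun p =>
    (¬ (p.1 = u ∨ p.1 = v ∨ p.1 = w ∨ p.1 = a ∨ p.1 = b ∨ p.1 = c) ∧
        ¬ (p.2 = u ∨ p.2 = v ∨ p.2 = w ∨ p.2 = a ∨ p.2 = b ∨ p.2 = c)) ∨
      (¬ (p.1 = u ∨ p.1 = v ∨ p.1 = w ∨ p.1 = a ∨ p.1 = b ∨ p.1 = c) ∧
        (p.2 = u ∨ p.2 = v ∨ p.2 = w ∨ p.2 = a ∨ p.2 = b ∨ p.2 = c) ∧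
        ¬ ((p.2 = u ∨ p.2 = v ∨ p.2 = w) ∧ (p.2 = a ∨ p.2 = b ∨ p.2 = c))) ∨
      (¬ (p.2 = u ∨ p.2 = v ∨ p.2 = w ∨ p.2 = a ∨ p.2 = b ∨ p.2 = c) ∧
        (p.1 = u ∨ p.1 = v ∨ p.1 = w ∨ p.1 = a ∨ p.1 = b ∨ p.1 = c) ∧
        ¬ ((p.1 = u ∨ p.1 = v ∨ p.1 = w) ∧ (p.1 = a ∨ p.1 = b ∨ p.1 = c))) with hG
  have hgood : (P.filter G).card ≤ ∑ p ∈ P, (S.filter (fun x => ¬ D.Adj p.1 x ∧ ¬ D.Adj p.2 x)).card := by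
    calc (P.filter G).card = ∑ p ∈ P.filter G, 1 := by rw [card_eq_sum_ones]
      _ ≤ ∑ p ∈ P.filter G, (S.filter (fun x => ¬ D.Adj p.1 x ∧ ¬ D.Adj p.2 x)).card := by
          apply sum_le_sum
          intro p hp
          rw [mem_filter] at hp
          exact one_le_card_far_of_good D hK huv huw hvw hab hac hbc p hp.2
      _ ≤ ∑ p ∈ P, (S.filter (fun x => ¬ D.Adj p.1 x ∧ ¬ D.Adj p.2 x)).card :=
          sum_le_sum_of_subset_of_nonneg (filter_subset _ _) (fun _ _ _ => Nat.zero_le _)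
  -- the bad pairs: inside `S`, or hanging on the shared vertex
  have hcover : P ⊆ P.filter G ∪ P.filter (fun p => p.1 ∈ S ∧ p.2 ∈ S) ∪
      P.filter (fun p => p.1 ∉ S ∧ ((p.2 = u ∨ p.2 = v ∨ p.2 = w) ∧ (p.2 = a ∨ p.2 = b ∨ p.2 = c))) ∪
      P.filter (fun p => p.2 ∉ S ∧ ((p.1 = u ∨ p.1 = v ∨ p.1 = w) ∧ (p.1 = a ∨ p.1 = b ∨ p.1 = c))) := by
    intro p hp
    simp only [mem_union, mem_filter, hG, memS]
    by_cases h1 : p.1 = u ∨ p.1 = v ∨ p.1 = w ∨ p.1 = a ∨ p.1 = b ∨ p.1 = c <;>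
      by_cases h2 : p.2 = u ∨ p.2 = v ∨ p.2 = w ∨ p.2 = a ∨ p.2 = b ∨ p.2 = c
    · exact Or.inl (Or.inl (Or.inr ⟨hp, h1, h2⟩))
    · by_cases hsh : (p.1 = u ∨ p.1 = v ∨ p.1 = w) ∧ (p.1 = a ∨ p.1 = b ∨ p.1 = c)
      · exact Or.inr ⟨hp, h2, hsh⟩
      · exact Or.inl (Or.inl (Or.inl ⟨hp, Or.inr (Or.inr ⟨h2, h1, hsh⟩)⟩))
    · by_cases hsh : (p.2 = u ∨ p.2 = v ∨ p.2 = w) ∧ (p.2 = a ∨ p.2 = b ∨ p.2 = c)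
      · exact Or.inl (Or.inr ⟨hp, h1, hsh⟩)
      · exact Or.inl (Or.inl (Or.inl ⟨hp, Or.inr (Or.inl ⟨h1, h2, hsh⟩)⟩))
    · exact Or.inl (Or.inl (Or.inl ⟨hp, Or.inl ⟨h1, h2⟩⟩))
  have hP2 : P.card = 2 * D.edgeFinset.card := card_adjPairsAll D
  have hcount := card_le_card hcover
  have hu1 := card_union_le (P.filter G ∪ P.filter (fun p => p.1 ∈ S ∧ p.2 ∈ S) ∪
      P.filter (fun p => p.1 ∉ S ∧ ((p.2 = u ∨ p.2 = v ∨ p.2 = w) ∧ (p.2 = a ∨ p.2 = b ∨ p.2 = c))))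
      (P.filter (fun p => p.2 ∉ S ∧ ((p.1 = u ∨ p.1 = v ∨ p.1 = w) ∧ (p.1 = a ∨ p.1 = b ∨ p.1 = c))))
  have hu2 := card_union_le (P.filter G ∪ P.filter (fun p => p.1 ∈ S ∧ p.2 ∈ S))
      (P.filter (fun p => p.1 ∉ S ∧ ((p.2 = u ∨ p.2 = v ∨ p.2 = w) ∧ (p.2 = a ∨ p.2 = b ∨ p.2 = c))))
  have hu3 := card_union_le (P.filter G) (P.filter (fun p => p.1 ∈ S ∧ p.2 ∈ S))
  omega

/-- **THE FAR COUNT AROUND TWO TRIANGLES:** `2m + 2 |Sᶜ| ≤ Σ_z far(z) + |P_S|` — the hanging pairs number at most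
`2 |Sᶜ|`, the shared vertex being unique. -/
theorem two_mul_card_edges_add_le_sum_far_add (D : SimpleGraph V) [DecidableRel D.Adj] (hK : K4mFree D)
    {u v w a b c : V}
    (huv : D.Adj u v) (huw : D.Adj u w) (hvw : D.Adj v w) (hab : D.Adj a b) (hac : D.Adj a c) (hbc : D.Adj b c)
    (ha : ¬ (a = u ∨ a = v ∨ a = w)) :
    2 * D.edgeFinset.card + 2 * (({u, v, w, a, b, c} : Finset V)ᶜ).card ≤ ∑ z, far D z +
      ((adjPairsAll D).filter (fun p => p.1 ∈ ({u, v, w, a, b, c} : Finset V) ∧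
        p.2 ∈ ({u, v, w, a, b, c} : Finset V))).card := by
  have h := two_mul_card_edges_add_four_mul_le D hK huv huw hvw hab hac hbc ha
  set S : Finset V := {u, v, w, a, b, c} with hS
  set P := adjPairsAll D with hP
  have hb2 : (P.filter (fun p => p.1 ∉ S ∧ ((p.2 = u ∨ p.2 = v ∨ p.2 = w) ∧ (p.2 = a ∨ p.2 = b ∨ p.2 = c)))).card ≤
      Sᶜ.card := by
    apply card_le_card_of_injOn (fun p => p.1)
    · intro p hp
      rw [mem_coe, mem_filter] at hp
      rw [mem_coe, mem_compl]
      exact hp.2.1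
    · intro p hp p' hp' hpp'
      rw [mem_coe, mem_filter] at hp hp'
      have h2 := shared_unique' D hK huv huw hvw hab hac hbc ha hp.2.2 hp'.2.2
      exact Prod.ext hpp' h2
  have hb3 : (P.filter (fun p => p.2 ∉ S ∧ ((p.1 = u ∨ p.1 = v ∨ p.1 = w) ∧ (p.1 = a ∨ p.1 = b ∨ p.1 = c)))).card ≤
      Sᶜ.card := by
    apply card_le_card_of_injOn (fun p => p.2)
    · intro p hp
      rw [mem_coe, mem_filter] at hp
      rw [mem_coe, mem_compl]
      exact hp.2.1
    · intro p hp p' hp' hpp'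
      rw [mem_coe, mem_filter] at hp hp'
      have h1 := shared_unique' D hK huv huw hvw hab hac hbc ha hp.2.2 hp'.2.2
      exact Prod.ext h1 hpp'
  omega

/-- **THE FAR COUNT FOR VERTEX-DISJOINT TRIANGLES:** no hanging pairs, `2m + 4 |Sᶜ| ≤ Σ_z far(z) + |P_S|`. -/
theorem two_mul_card_edges_add_four_mul_le_of_disjoint (D : SimpleGraph V) [DecidableRel D.Adj] (hK : K4mFree D)
    {u v w a b c : V}
    (huv : D.Adj u v) (huw : D.Adj u w) (hvw : D.Adj v w) (hab : D.Adj a b) (hac : D.Adj a c) (hbc : D.Adj b c)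
    (ha : ¬ (a = u ∨ a = v ∨ a = w)) (hdisj : ∀ t, (t = u ∨ t = v ∨ t = w) → ¬ (t = a ∨ t = b ∨ t = c)) :
    2 * D.edgeFinset.card + 4 * (({u, v, w, a, b, c} : Finset V)ᶜ).card ≤ ∑ z, far D z +
      ((adjPairsAll D).filter (fun p => p.1 ∈ ({u, v, w, a, b, c} : Finset V) ∧
        p.2 ∈ ({u, v, w, a, b, c} : Finset V))).card := by
  have h := two_mul_card_edges_add_four_mul_le D hK huv huw hvw hab hac hbc ha
  have h1 : ((adjPairsAll D).filter (fun p => p.1 ∉ ({u, v, w, a, b, c} : Finset V) ∧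
      ((p.2 = u ∨ p.2 = v ∨ p.2 = w) ∧ (p.2 = a ∨ p.2 = b ∨ p.2 = c)))).card = 0 := by
    rw [card_eq_zero, filter_eq_empty_iff]
    intro p _ hp
    exact hdisj p.2 hp.2.1 hp.2.2
  have h2 : ((adjPairsAll D).filter (fun p => p.2 ∉ ({u, v, w, a, b, c} : Finset V) ∧
      ((p.1 = u ∨ p.1 = v ∨ p.1 = w) ∧ (p.1 = a ∨ p.1 = b ∨ p.1 = c)))).card = 0 := by
    rw [card_eq_zero, filter_eq_empty_iff]
    intro p _ hp
    exact hdisj p.1 hp.2.1 hp.2.2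
  omega


/-- **THE TWO-TRIANGLE CASE OF THE `r = 2` STABILITY FOR `k ≥ 27`** (the pairs inside `S` bounded by `|S|(|S| − 1) ≤ 30`). -/
theorem two_triangles_stability_two_large (D : SimpleGraph V) [DecidableRel D.Adj] (hK : K4mFree D)
    (hk : 27 ≤ Fintype.card V) (hm : 2 * Fintype.card V ≤ D.edgeFinset.card + 3) {u v w a b c : V}
    (huv : D.Adj u v) (huw : D.Adj u w) (hvw : D.Adj v w) (hab : D.Adj a b) (hac : D.Adj a c) (hbc : D.Adj b c)
    (ha : ¬ (a = u ∨ a = v ∨ a = w)) :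
    ∑ v, deg D v * deg D v + 2 * (Fintype.card V - 3) ≤ D.edgeFinset.card * Fintype.card V := by
  by_cases h18 : 18 ≤ (triangles3 D).card
  · exact stability_two_of_eighteen D hK (by omega) h18
  have hT17 : (triangles3 D).card ≤ 17 := by omega
  have hid := two_mul_sum_deg_sq_add_sum_deficit D
  have hmk : 2 * (D.edgeFinset.card * Fintype.card V) = 2 * D.edgeFinset.card * Fintype.card V := by ring
  suffices hkey : 4 * Fintype.card V + 5 ≤ ∑ p ∈ adjPairsAll D, deficit D p by omega
  rw [sum_deficit_eq_sum_far]
  have hcount := two_mul_card_edges_add_le_sum_far_add D hK huv huw hvw hab hac hbc ha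
  set S : Finset V := {u, v, w, a, b, c} with hS
  have hS6 : S.card ≤ 6 := card_le_six
  have hb1 : ((adjPairsAll D).filter (fun p => p.1 ∈ S ∧ p.2 ∈ S)).card ≤ S.card * S.card - S.card := by
    rw [← offDiag_card]
    apply card_le_card
    intro p hp
    rw [mem_filter, mem_adjPairsAll] at hp
    rw [mem_offDiag]
    exact ⟨hp.2.1, hp.2.2, hp.1.ne⟩
  have hSc := card_compl S
  have hSS : S.card * S.card ≤ 36 := by nlinarith
  have hSS' : S.card ≤ S.card * S.card := Nat.le_mul_self _
  omega

end C047

end TriangleCap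

end PercRepro
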